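import Literature.NumberTheory.Sieve.PrimesInProgressionsFixedModulus
import Literature.NumberTheory.Sieve.MaynardSieveLevel
import HarnessLib

/-!
# Route `RoughParitySectors`, crux `OddSectorShareLinear` (stmt-Parity-15629), line `birth`:
# helpers II for the stub `stub_sieveDecouplingPrime` — the prime-counting side

`--supports stmt-Parity-15629`.  For the decoupling sieve of the stub S'a the sifted sequence is
`𝒜 = {1 ≤ n ≤ x : αn + β prime ≥ z}` (`f_m = αX + β`, `α ≥ 1`), and its distribution in the classes
`c mod d` is that of the primes `q = αn + β ≤ αx + β` in the classes `αc + β mod αd`.  This file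
records:

* `linear_cell_one_iff`: the one-form prime cell "`αn + β > 0`, free of primes `< z`, `Ω = 1`" is
  "`αn + β` is a prime `≥ z`";
* `card_filter_mod_eq`: `#{n ∈ 𝒜 : n ≡ c (d)} = #{z ≤ q ≤ αx + β prime : q ≡ αc + β (αd)}`
  (the bijection `n ↦ αn + β`);
* `abs_card_sub_le`: hence `|#{n ∈ 𝒜 : n ≡ c (d)} − (π(αx+β) − π(z−1))/φ(αd)| ≤ E_π(αx+β; αd) + z`
  with Maynard's `primeCountingAPErr`;
* `isUnit_linear_class`: `αc + β` is a unit modulo `αd` when no prime factor of `d` divides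
  `αc + β` and no prime divides both `α` and `β`;
* `exists_eventually_weighted_bv`: the divisor-weighted Bombieri–Vinogradov bound
  `∑_{q ≤ t^{1/4}} K^{ω(q)} E_π(t; q) ≤ C t/(log t)^A` (`BombieriVinogradovStatement_holds`,
  `MaynardPrimesHaveLevel.isBigO_sum_pow_omega_mul`), the change of moduli `d ↦ αd`
  (`sum_mul_reindex_le`) and `αx + β → ∞` (`tendsto_linear_toNat`).
-/

noncomputable section

open Filter Finset
open scoped BigOperators ArithmeticFunction.Omega ArithmeticFunction.omega
open Literature.NumberTheory.Sieve

namespace Summit.Parity.BatemanHorn.Cruxes.OddSectorShareLinear.Birth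

namespace SieveDecoupling

/-! ### The one-form prime cell of a linear form -/

/-- The one-form prime cell: "`αn + β > 0`, no prime `< z` divides `αn + β`, `Ω(αn + β) = 1`" iff
"`αn + β` is a prime `≥ z`". [folklore] -/
theorem linear_cell_one_iff {α β : ℤ} {z n : ℕ} :
    ((0 < α * n + β ∧ ∀ p ∈ range z, p.Prime → ¬ ((p : ℤ) ∣ α * n + β)) ∧
        Ω (α * n + β).toNat = 1) ↔
      (α * n + β).toNat.Prime ∧ z ≤ (α * n + β).toNat := by
  rw [ArithmeticFunction.cardFactors_eq_one_iff_prime]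
  constructor
  · rintro ⟨⟨hpos, hrough⟩, hprime⟩
    refine ⟨hprime, ?_⟩
    by_contra hlt
    push Not at hlt
    refine hrough _ (mem_range.mpr hlt) hprime ?_
    rw [Int.toNat_of_nonneg hpos.le]
  · rintro ⟨hprime, hz⟩
    have hpos : 0 < α * n + β := by
      by_contra h
      push Not at h
      rw [Int.toNat_eq_zero.mpr h] at hprime
      exact Nat.not_prime_zero hprime
    refine ⟨⟨hpos, fun p hp hpp hdvd => ?_⟩, hprime⟩
    rw [← Int.toNat_of_nonneg hpos.le, Int.natCast_dvd_natCast] at hdvd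
    have := (Nat.prime_dvd_prime_iff_eq hpp hprime).mp hdvd
    rw [mem_range] at hp
    omega

/-! ### The classes `c mod d` of `𝒜` are classes of primes modulo `αd` -/

/-- **The bijection `n ↦ αn + β`.**  For `α ≥ 1`, `c < d`, `z > β` and `αx + β ≥ 0`:
`#{1 ≤ n ≤ x : αn + β prime ≥ z, n ≡ c (d)} = #{z ≤ q ≤ αx + β : q prime, q ≡ a (αd)}` whenever
`a ≡ αc + β (mod αd)`. [folklore] -/
theorem card_filter_mod_eq {α β : ℤ} (hα : 0 < α) {x z d c a : ℕ} (hcd : c < d)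
    (hzβ : β < z) (hx : 0 ≤ α * x + β)
    (ha : ((a : ℕ) : ZMod (α.toNat * d)) = ((α * c + β : ℤ) : ZMod (α.toNat * d))) :
    #(((Icc 1 x).filter (fun n : ℕ => (0 < α * n + β ∧
        ∀ p ∈ range z, p.Prime → ¬ ((p : ℤ) ∣ α * n + β)) ∧ Ω (α * n + β).toNat = 1)).filter
        (fun n : ℕ => n % d = c)) =
      #((Ico z ((α * x + β).toNat + 1)).filter
        (fun q : ℕ => q.Prime ∧ q ≡ a [MOD α.toNat * d])) := by
  have hαZ : ((α.toNat : ℕ) : ℤ) = α := Int.toNat_of_nonneg hα.le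
  have hM : ((α.toNat * d : ℕ) : ℤ) = α * d := by push_cast; rw [hαZ]
  have hyZ : (((α * x + β).toNat : ℕ) : ℤ) = α * x + β := Int.toNat_of_nonneg hx
  have key : ∀ q : ℕ, q ≡ a [MOD α.toNat * d] ↔ (α * d : ℤ) ∣ (α * c + β) - q := by
    intro q
    have e : ((q : ℕ) : ZMod (α.toNat * d)) = ((q : ℤ) : ZMod (α.toNat * d)) :=
      (Int.cast_natCast q).symm
    rw [← ZMod.natCast_eq_natCast_iff, ha, e, ZMod.intCast_eq_intCast_iff_dvd_sub, hM]
  -- the inverse map lands in the source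
  have hback : ∀ q ∈ (Ico z ((α * x + β).toNat + 1)).filter
      (fun q : ℕ => q.Prime ∧ q ≡ a [MOD α.toNat * d]),
      α * (((q : ℤ) - β) / α) = q - β ∧ 1 ≤ ((q : ℤ) - β) / α ∧ ((q : ℤ) - β) / α ≤ x ∧
        (d : ℤ) ∣ (c : ℤ) - (((q : ℤ) - β) / α) := by
    intro q hq
    rw [mem_filter, mem_Ico] at hq
    obtain ⟨⟨hzq, hqy⟩, -, hmod⟩ := hq
    have h1 : (α * d : ℤ) ∣ (α * c + β) - q := (key q).mp hmod
    have h2 : α ∣ (q : ℤ) - β := by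
      have h3 : α ∣ (α * c + β) - q := (dvd_mul_right α d).trans h1
      have : (q : ℤ) - β = α * c - ((α * c + β) - q) := by ring
      rw [this]
      exact dvd_sub (dvd_mul_right α c) h3
    have he : α * (((q : ℤ) - β) / α) = q - β := Int.mul_ediv_cancel' h2
    have hqz : (z : ℤ) ≤ q := by exact_mod_cast hzq
    have hqy' : (q : ℤ) ≤ α * x + β := by
      have : q ≤ (α * x + β).toNat := Nat.lt_succ_iff.mp hqy
      have : (q : ℤ) ≤ (((α * x + β).toNat : ℕ) : ℤ) := by exact_mod_cast this
      rwa [hyZ] at this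
    refine ⟨he, ?_, ?_, ?_⟩
    · by_contra hlt
      push Not at hlt
      have : α * (((q : ℤ) - β) / α) ≤ 0 := by nlinarith
      linarith
    · by_contra hlt
      push Not at hlt
      have : α * (x : ℤ) < α * (((q : ℤ) - β) / α) := by nlinarith
      linarith
    · have h4 : (α * d : ℤ) ∣ α * ((c : ℤ) - (((q : ℤ) - β) / α)) := by
        have : α * ((c : ℤ) - (((q : ℤ) - β) / α)) = (α * c + β) - q := by rw [mul_sub, he]; ring
        rwa [this]
      exact (mul_dvd_mul_iff_left hα.ne').mp h4
  refine Finset.card_nbij' (fun n : ℕ => (α * n + β).toNat) (fun q : ℕ => (((q : ℤ) - β) / α).toNat)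
    (fun n hn => ?_) (fun q hq => ?_) (fun n hn => ?_) (fun q hq => ?_)
  · -- forward map
    have hn' : n ∈ ((Icc 1 x).filter (fun n : ℕ => (0 < α * n + β ∧
        ∀ p ∈ range z, p.Prime → ¬ ((p : ℤ) ∣ α * n + β)) ∧ Ω (α * n + β).toNat = 1)).filter
        (fun n : ℕ => n % d = c) := hn
    rw [mem_filter, mem_filter, linear_cell_one_iff, mem_Icc] at hn'
    obtain ⟨⟨⟨-, hnx⟩, hprime, hzq⟩, hmod⟩ := hn'
    have hpos : 0 ≤ α * n + β := by
      have := hprime.pos; by_contra h; push Not at h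
      rw [Int.toNat_eq_zero.mpr h.le] at this; exact lt_irrefl 0 this
    show (α * n + β).toNat ∈ (Ico z ((α * x + β).toNat + 1)).filter
        (fun q : ℕ => q.Prime ∧ q ≡ a [MOD α.toNat * d])
    rw [mem_filter, mem_Ico, Nat.lt_succ_iff, key, Int.toNat_of_nonneg hpos]
    refine ⟨⟨hzq, Int.toNat_le_toNat (by nlinarith)⟩, hprime, ?_⟩
    have hnc : n ≡ c [MOD d] := by rw [Nat.ModEq, hmod, Nat.mod_eq_of_lt hcd]
    have hdvd : (d : ℤ) ∣ (c : ℤ) - n := Nat.modEq_iff_dvd.mp hnc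
    have : (α * c + β) - (α * n + β) = α * ((c : ℤ) - n) := by ring
    rw [this]
    exact mul_dvd_mul_left α hdvd
  · -- backward map
    obtain ⟨he, h1, hx', hdvd⟩ := hback q hq
    have hq' := hq
    rw [mem_coe, mem_filter, mem_Ico] at hq'
    obtain ⟨⟨hzq, -⟩, hprime, -⟩ := hq'
    set n₀ : ℤ := ((q : ℤ) - β) / α with hn₀
    have hn₀0 : 0 ≤ n₀ := by linarith
    have hnZ : ((n₀.toNat : ℕ) : ℤ) = n₀ := Int.toNat_of_nonneg hn₀0
    have hval : α * ((n₀.toNat : ℕ) : ℤ) + β = q := by rw [hnZ, he]; ring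
    show n₀.toNat ∈ ((Icc 1 x).filter (fun n : ℕ => (0 < α * n + β ∧
        ∀ p ∈ range z, p.Prime → ¬ ((p : ℤ) ∣ α * n + β)) ∧ Ω (α * n + β).toNat = 1)).filter
        (fun n : ℕ => n % d = c)
    rw [mem_filter, mem_filter, linear_cell_one_iff, mem_Icc, hval, Int.toNat_natCast]
    refine ⟨⟨⟨by omega, by omega⟩, hprime, hzq⟩, ?_⟩
    have hnc : n₀.toNat ≡ c [MOD d] := Nat.modEq_iff_dvd.mpr (by rwa [hnZ])
    rw [hnc, Nat.mod_eq_of_lt hcd]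
  · -- left inverse
    have hn' : n ∈ ((Icc 1 x).filter (fun n : ℕ => (0 < α * n + β ∧
        ∀ p ∈ range z, p.Prime → ¬ ((p : ℤ) ∣ α * n + β)) ∧ Ω (α * n + β).toNat = 1)).filter
        (fun n : ℕ => n % d = c) := hn
    rw [mem_filter, mem_filter] at hn'
    have hpos : 0 ≤ α * n + β := hn'.1.2.1.1.le
    show (((((α * n + β).toNat : ℕ) : ℤ) - β) / α).toNat = n
    rw [Int.toNat_of_nonneg hpos, add_sub_cancel_right, Int.mul_ediv_cancel_left _ hα.ne',
      Int.toNat_natCast]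
  · -- right inverse
    obtain ⟨he, h1, -, -⟩ := hback q hq
    have hn₀0 : 0 ≤ ((q : ℤ) - β) / α := by linarith
    show (α * ((((((q : ℤ) - β) / α).toNat : ℕ)) : ℤ) + β).toNat = q
    rw [Int.toNat_of_nonneg hn₀0, he, sub_add_cancel, Int.toNat_natCast]

/-- Splitting a count over `range (y + 1)` at `z ≤ y + 1`. [folklore] -/
theorem card_filter_range_succ_eq_add {z y : ℕ} (hzy : z ≤ y + 1) (P : ℕ → Prop) [DecidablePred P] :
    #((range (y + 1)).filter P) = #((range z).filter P) + #((Ico z (y + 1)).filter P) := by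
  rw [range_eq_Ico, range_eq_Ico, ← Ico_union_Ico_eq_Ico (Nat.zero_le z) hzy, filter_union,
    card_union_of_disjoint]
  exact disjoint_filter_filter (Ico_disjoint_Ico_consecutive 0 z (y + 1))

/-- **The class count against its expectation.**  For `z ≤ y + 1` and a unit `u` of
`ℤ/d'`: `|#{z ≤ q ≤ y prime : q ≡ u (d')} − (π(y) − π(z − 1))/φ(d')| ≤ E_π(y; d') + z`, where
`E_π(y; d') = max_{(a, d') = 1} |π(y; d', a) − π(y)/φ(d')|` (`primeCountingAPErr`): above `z` the
discrepancy is at most `E_π`, below `z` both counts are at most `z`. [folklore] -/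
theorem abs_card_sub_le {z y d' : ℕ} (hzy : z ≤ y + 1) (u : (ZMod d')ˣ) :
    |(#((Ico z (y + 1)).filter (fun q : ℕ => q.Prime ∧ q ≡ (u : ZMod d').val [MOD d'])) : ℝ) -
        ((Nat.primeCounting y : ℝ) - Nat.primeCounting (z - 1)) / Nat.totient d'| ≤
      primeCountingAPErr (y : ℝ) d' + z := by
  set a : ℕ := (u : ZMod d').val with ha
  have hsplit := card_filter_range_succ_eq_add hzy (fun q : ℕ => q.Prime ∧ q ≡ a [MOD d'])
  have hPiy : (LevelOfDistribution.primeCountingMod d' a y : ℝ) =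
      #((range z).filter (fun q : ℕ => q.Prime ∧ q ≡ a [MOD d'])) +
        #((Ico z (y + 1)).filter (fun q : ℕ => q.Prime ∧ q ≡ a [MOD d'])) := by
    rw [LevelOfDistribution.primeCountingMod, hsplit, Nat.cast_add]
  have hE := abs_sub_le_primeCountingAPErr (y : ℝ) u
  rw [Nat.floor_natCast, ← ha, hPiy] at hE
  -- the part below `z`
  have hlow1 : (#((range z).filter (fun q : ℕ => q.Prime ∧ q ≡ a [MOD d'])) : ℝ) ≤ z := by
    exact_mod_cast (card_filter_le _ _).trans (card_range z).le
  have hlow2 : (Nat.primeCounting (z - 1) : ℝ) ≤ z := by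
    have h : Nat.primeCounting (z - 1) ≤ z := by
      rw [Nat.primeCounting_sub_one, ← Nat.primesBelow_card_eq_primeCounting']
      exact (card_filter_le _ _).trans (card_range z).le
    exact_mod_cast h
  have hφ1 : (1 : ℝ) ≤ Nat.totient d' ∨ d' = 0 := by
    rcases Nat.eq_zero_or_pos d' with h | h
    · exact Or.inr h
    · exact Or.inl (by exact_mod_cast Nat.totient_pos.mpr h)
  have hlow3 : (0 : ℝ) ≤ (Nat.primeCounting (z - 1) : ℝ) / Nat.totient d' := by positivity
  have hlow4 : (Nat.primeCounting (z - 1) : ℝ) / Nat.totient d' ≤ z := by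
    rcases hφ1 with h | h
    · exact (div_le_self (Nat.cast_nonneg _) h).trans hlow2
    · subst h
      rw [Nat.totient_zero, Nat.cast_zero, div_zero]
      exact Nat.cast_nonneg _
  have hlow0 : (0 : ℝ) ≤ #((range z).filter (fun q : ℕ => q.Prime ∧ q ≡ a [MOD d'])) :=
    Nat.cast_nonneg _
  rw [abs_le] at hE ⊢
  constructor
  · have := hE.1
    rw [sub_div] 
    nlinarith [primeCountingAPErr_nonneg (y : ℝ) d']
  · have := hE.2
    rw [sub_div]
    nlinarith [primeCountingAPErr_nonneg (y : ℝ) d']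

/-- **The class `αc + β` is invertible modulo `αd`** when no prime divides both `α` and `β` and no
prime factor of `d` divides `αc + β`. [folklore] -/
theorem isUnit_linear_class {α β : ℤ} (hα : 0 < α)
    (hαβ : ∀ p : ℕ, p.Prime → (p : ℤ) ∣ α → ¬ ((p : ℤ) ∣ β)) {d : ℕ} (hd : d ≠ 0) {c : ℕ}
    (hc : ∀ p ∈ d.primeFactors, ¬ ((p : ℤ) ∣ α * c + β)) :
    IsUnit (((α * c + β : ℤ)) : ZMod (α.toNat * d)) := by
  have hαZ : ((α.toNat : ℕ) : ℤ) = α := Int.toNat_of_nonneg hα.le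
  rw [ZMod.coe_int_isUnit_iff_isCoprime, Int.isCoprime_iff_gcd_eq_one, Int.gcd_eq_natAbs,
    Int.natAbs_natCast]
  refine Nat.coprime_of_dvd fun p hp hpM hpv => ?_
  have hpv' : (p : ℤ) ∣ α * c + β := Int.natAbs_dvd_natAbs.mp (by rwa [Int.natAbs_natCast])
  rcases (Nat.Prime.dvd_mul hp).mp hpM with h | h
  · have hpa : (p : ℤ) ∣ α := by rw [← hαZ]; exact Int.natCast_dvd_natCast.mpr h
    refine hαβ p hp hpa ?_
    have e : β = (α * c + β) - α * c := by ring
    rw [e]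
    exact dvd_sub hpv' (hpa.mul_right _)
  · exact hc p (Nat.mem_primeFactors.mpr ⟨hp, h, hd⟩) hpv'

/-! ### Bombieri–Vinogradov with divisor weights, and the change of moduli `d ↦ αd` -/

/-- **Divisor-weighted Bombieri–Vinogradov at level `t^{1/4}`**: for `K ≥ 0`, `A > 0` there is `C`
with `∑_{q ≤ t^{1/4}} K^{ω(q)} E_π(t; q) ≤ C t/(log t)^A` for all large real `t`
(`BombieriVinogradovStatement_holds` in `π`-form at `θ = 1/3`, Maynard's level hypothesis at `1/4`,
`MaynardPrimesHaveLevel.isBigO_sum_pow_omega_mul`). [folklore] -/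
theorem exists_eventually_weighted_bv {K : ℝ} (hK : 0 ≤ K) {A : ℝ} (hA : 0 < A) :
    ∃ C : ℝ, ∀ᶠ t : ℝ in atTop,
      ∑ q ∈ Icc 1 ⌊t ^ (1 / 4 : ℝ)⌋₊, K ^ ω q * primeCountingAPErr t q ≤
        C * t / Real.log t ^ A := by
  have hlev : MaynardPrimesHaveLevel (1 / 4 : ℝ) :=
    maynardPrimesHaveLevel_of_primesHaveLevelPi
      (BombieriVinogradovStatement_holds.primesHaveLevelPi (θ := 1 / 3) (by norm_num)) (by norm_num)
  obtain ⟨c, _, hc⟩ := (hlev.isBigO_sum_pow_omega_mul hK hA).exists_pos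
  rw [Asymptotics.IsBigOWith] at hc
  refine ⟨c, ?_⟩
  filter_upwards [hc, eventually_ge_atTop (2 : ℝ)] with t ht ht2
  have hlog : 0 < Real.log t := Real.log_pos (by linarith)
  rw [Real.norm_of_nonneg (Finset.sum_nonneg fun q _ => mul_nonneg (pow_nonneg hK _)
    (primeCountingAPErr_nonneg _ _)), Real.norm_of_nonneg (by positivity)] at ht
  calc _ ≤ c * (t / Real.log t ^ A) := ht
    _ = c * t / Real.log t ^ A := by ring

/-- `αx + β → ∞` along `x → ∞` (`α ≥ 1`), as a real sequence of the natural numbers `(αx + β)⁺`. [folklore] -/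
theorem tendsto_linear_toNat {α β : ℤ} (hα : 0 < α) :
    Tendsto (fun x : ℕ => (((α * x + β).toNat : ℕ) : ℝ)) atTop atTop := by
  refine tendsto_atTop_mono (fun x => ?_)
    (tendsto_atTop_add_const_right atTop (β : ℝ) tendsto_natCast_atTop_atTop)
  have h1 : α * x + β ≤ (((α * x + β).toNat : ℕ) : ℤ) := Int.self_le_toNat _
  have h2 : (x : ℤ) + β ≤ α * x + β := by nlinarith
  have h3 : (x : ℤ) + β ≤ (((α * x + β).toNat : ℕ) : ℤ) := h2.trans h1
  exact_mod_cast h3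

/-- **Change of moduli.**  If every `d ∈ s` has `d ≠ 0` and `ad ≤ M` (`a ≥ 1`), then for `K ≥ 1`
and `F ≥ 0`: `∑_{d ∈ s} K^{ω(d)} F(ad) ≤ ∑_{q ≤ M} K^{ω(q)} F(q)` (`ω(d) ≤ ω(ad)`, `d ↦ ad`
injective). [folklore] -/
theorem sum_mul_reindex_le {s : Finset ℕ} {a M : ℕ} (ha : 0 < a)
    (hs : ∀ d ∈ s, d ≠ 0 ∧ a * d ≤ M) {K : ℝ} (hK : 1 ≤ K) {F : ℕ → ℝ} (hF : ∀ q, 0 ≤ F q) :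
    ∑ d ∈ s, K ^ ω d * F (a * d) ≤ ∑ q ∈ Icc 1 M, K ^ ω q * F q := by
  have hω : ∀ d : ℕ, d ≠ 0 → ω d ≤ ω (a * d) := fun d hd => by
    rw [ArithmeticFunction.cardDistinctFactors_apply, ArithmeticFunction.cardDistinctFactors_apply,
      ← List.card_toFinset, ← List.card_toFinset, Nat.toFinset_factors, Nat.toFinset_factors]
    exact card_le_card (Nat.primeFactors_mono (dvd_mul_left d a) (Nat.mul_ne_zero ha.ne' hd))
  calc ∑ d ∈ s, K ^ ω d * F (a * d) ≤ ∑ d ∈ s, K ^ ω (a * d) * F (a * d) :=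
        sum_le_sum fun d hd => mul_le_mul_of_nonneg_right
          (pow_le_pow_right₀ hK (hω d (hs d hd).1)) (hF _)
    _ = ∑ q ∈ s.image (fun d => a * d), K ^ ω q * F q := by
        rw [sum_image fun d₁ _ d₂ _ h => mul_left_cancel₀ ha.ne' h]
    _ ≤ ∑ q ∈ Icc 1 M, K ^ ω q * F q := by
        refine sum_le_sum_of_subset_of_nonneg (fun q hq => ?_) fun q _ _ =>
          mul_nonneg (pow_nonneg (zero_le_one.trans hK) _) (hF q)
        obtain ⟨d, hd, rfl⟩ := mem_image.mp hq
        rw [mem_Icc]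
        exact ⟨Nat.mul_pos ha (Nat.pos_of_ne_zero (hs d hd).1), (hs d hd).2⟩

end SieveDecoupling

/-- **Sub-goal (divisor-weighted Bombieri–Vinogradov at level `t^{1/4}`)** of the stub
`stub_sieveDecouplingPrime` (crux stmt-Parity-15629, line `birth`): for `K ≥ 0` and `A > 0` there is
`C` with `∑_{q ≤ t^{1/4}} K^{ω(q)} E_π(t; q) ≤ C t/(log t)^A` for all large `t`
(`SieveDecoupling.exists_eventually_weighted_bv`). [folklore] -/
theorem stub_decouplingWeightedBV :
    ∀ K : ℝ, 0 ≤ K → ∀ A : ℝ, 0 < A → ∃ C : ℝ, ∀ᶠ t : ℝ in Filter.atTop, ∑ q ∈ Finset.Icc 1 ⌊t ^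
    (1 / 4 : ℝ)⌋₊, K ^ (ArithmeticFunction.cardDistinctFactors q) *
    Literature.NumberTheory.Sieve.primeCountingAPErr t q ≤ C * t / Real.log t ^ A :=
  fun _ hK _ hA => SieveDecoupling.exists_eventually_weighted_bv hK hA

end Summit.Parity.BatemanHorn.Cruxes.OddSectorShareLinear.Birth

end
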